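import Summits.ResolutionOfSingularities.ResolutionOfSingularities.Theorems.FrobeniusLadderFRationalResolutionTraceIdealDivisorial
import Mathlib.RingTheory.IntegralClosure.IntegrallyClosed
import Mathlib.RingTheory.Localization.FractionRing
import Mathlib.Tactic.LinearCombination
import HarnessLib

/-!
# Crux `FrobeniusLadder.FRationalResolution` (stmt-ResolutionOfSingularities-15317), line `redirect`,
# stub `stub_diagonalizableQuotientResolution` — A DIVISORIAL IDEAL IS CUT OUT BY ITS GCD IN A UFD COVER
# (first half of (α′) «finitely many divisorial classes» for the toric germ `Ê ⊇ κ'[[P]] ⊆ κ'[[x,y,z]]`)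

Toward the `hfin` slot of `…CompletionDomain.hloc_of_traceIdealCentre_then_finite_singularPoints_of_isIntegrallyClosed` (p840173): the
divisorial ideals of `R = κ'[[P]] = S₀ ⊆ S = κ'[[x,y,z]]` are to be classified by the `ℤ/r`-isotypic pieces `S_w`. The classification has a
GRADING-FREE half, proved here for any integral extension of domains `R ⊆ S` with `S` a UFD and `R = S ∩ Frac R`:

* `exists_algebraMap_eq_of_isIntegrallyClosed` — `R` integrally closed and `S` integral over `R` ⇒ **`S ∩ Frac R = R`**: if `r₂ x = r₁` in `S`
  (`r₂ ≠ 0`) then `x ∈ R`;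
* ★★ `mem_iff_gcd_dvd_of_divisorial` — for a (nonzero or not) divisorial ideal `I = (G)` of `R` and `d = gcd_S(G)`: **`x ∈ I ⟺ d ∣ x` in `S`**.
  (`⟹`: `d` divides the generators; `⟸`: the v-test — `b I ⊆ c R` gives `c ∣ b d` in `S` (`…TraceIdealDivisorial.dvd_mul_foldr_gcd`), so
  `c ∣ b x` in `S`, and the quotient lies in `S ∩ Frac R = R`);
* ★ `nonempty_linearEquiv_of_divisorial` — consequently **`I ≅ M_d := {s ∈ S : d·s ∈ R}`** as `R`-modules (multiplication by `d`), so the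
  isomorphism class of `I` — hence its trace ideal `τ(I)` (p839642 `traceIdeal_eq_of_linearEquiv`) — only depends on `d` up to the
  relation `M_d = M_{d'}`; for the graded germ `S = κ'[[x,y,z]] ⊇ S₀ = R`, `d` may be taken HOMOGENEOUS (graded reflexive hulls, the second
  half, not done here) and then `M_d = S_{−deg d}`: at most `r` classes.

Honest label: general commutative algebra toward ONE leaf stub (no stub, crux or summit closed). No definitions, no named facts, no sorry.
[cite: Matsumura1987, §11; Thm. 20.3] [cite: StacksProject, Tag 0AFW] [folklore; Fossum, The divisor class group of a Krull domain, §16]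
-/

-- single-problem summit: the doubled namespace component is forced
set_option linter.dupNamespace false

open Summit.ResolutionOfSingularities.ResolutionOfSingularities.Theorems.FRationalResolution

namespace Summit.ResolutionOfSingularities.ResolutionOfSingularities.Theorems.FRationalResolution.DivisorialGcd

universe u

/-! ## §1 `S ∩ Frac R = R` -/

/-- **`S ∩ Frac R = R`** for `R` an integrally closed domain and `S ⊇ R` an integral extension of domains: if `r₂ · x = r₁` in `S` with
`r₂ ≠ 0` then `x` comes from `R` (the fraction `r₁/r₂ ∈ Frac R` is integral over `R`). [cite: Matsumura1987, §9] [folklore] -/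
theorem exists_algebraMap_eq_of_isIntegrallyClosed {R S : Type u} [CommRing R] [IsDomain R] [IsIntegrallyClosed R]
    [CommRing S] [IsDomain S] [Algebra R S] [Algebra.IsIntegral R S] (hinj : Function.Injective (algebraMap R S))
    (x : S) (r₁ r₂ : R) (hr₂ : r₂ ≠ 0) (hx : algebraMap R S r₂ * x = algebraMap R S r₁) :
    ∃ r : R, algebraMap R S r = x := by
  classical
  let L := FractionRing S
  haveI : FaithfulSMul R L := (faithfulSMul_iff_algebraMap_injective R L).mpr
    ((IsFractionRing.injective S L).comp (by
      have : algebraMap R L = (algebraMap S L).comp (algebraMap R S) := IsScalarTower.algebraMap_eq R S L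
      rw [this] at *
      exact hinj))
  letI : Algebra (FractionRing R) L := FractionRing.liftAlgebra R L
  haveI : IsScalarTower R (FractionRing R) L := FractionRing.isScalarTower_liftAlgebra R L
  set z : L := algebraMap S L x with hz
  have hzint : IsIntegral R z := (Algebra.IsIntegral.isIntegral (R := R) x).map (IsScalarTower.toAlgHom R S L)
  have hr₂L : algebraMap R L r₂ ≠ 0 := fun h =>
    hr₂ ((FaithfulSMul.algebraMap_injective R L) (by rw [h, map_zero]))
  have hzq : z = algebraMap R L r₁ / algebraMap R L r₂ := by
    rw [eq_div_iff hr₂L, IsScalarTower.algebraMap_apply R S L r₂, IsScalarTower.algebraMap_apply R S L r₁, hz, ← map_mul,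
      mul_comm, hx]
  -- the fraction `q = r₁ / r₂ ∈ Frac R` maps to `z` and is integral over `R`
  set q : FractionRing R := algebraMap R (FractionRing R) r₁ / algebraMap R (FractionRing R) r₂ with hq
  have hqz : IsScalarTower.toAlgHom R (FractionRing R) L q = z := by
    rw [IsScalarTower.coe_toAlgHom', hq, map_div₀, ← IsScalarTower.algebraMap_apply, ← IsScalarTower.algebraMap_apply, hzq]
  have hqint : IsIntegral R q := by
    rw [← isIntegral_algHom_iff (IsScalarTower.toAlgHom R (FractionRing R) L) (algebraMap (FractionRing R) L).injective, hqz]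
    exact hzint
  obtain ⟨r, hr⟩ := IsIntegrallyClosed.algebraMap_eq_of_integral hqint
  refine ⟨r, IsFractionRing.injective S L ?_⟩
  rw [← IsScalarTower.algebraMap_apply R S L, ← hz, ← hqz, ← hr, IsScalarTower.coe_toAlgHom',
    ← IsScalarTower.algebraMap_apply]

/-! ## §2 A divisorial ideal is cut out by its gcd -/

/-- A gcd-fold of zeros is zero. [folklore] -/
theorem foldr_gcd_eq_zero {S : Type u} [CommRing S] [IsDomain S] [GCDMonoid S] (L : List S) (h : ∀ g ∈ L, g = 0) :
    L.foldr gcd 0 = 0 := by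
  refine zero_dvd_iff.mp ?_
  induction L with
  | nil => simp
  | cons a L ih =>
    rw [List.foldr_cons]
    exact dvd_gcd (zero_dvd_iff.mpr (h a (by simp))) (ih fun g hg => h g (List.mem_cons_of_mem a hg))

/-- The gcd-fold divides every `R`-linear combination: `{x : d ∣ φ x}` contains the span of the generators. [folklore] -/
theorem foldr_gcd_dvd_of_mem_span {R S : Type u} [CommRing R] [CommRing S] [IsDomain S] [GCDMonoid S] [Algebra R S]
    (G : Finset R) {x : R} (hx : x ∈ Ideal.span (G : Set R)) :
    (G.toList.map (algebraMap R S)).foldr gcd 0 ∣ algebraMap R S x := by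
  have hle : Ideal.span (G : Set R) ≤ (Ideal.span {(G.toList.map (algebraMap R S)).foldr gcd 0}).comap (algebraMap R S) := by
    rw [Ideal.span_le]
    intro g hg
    rw [SetLike.mem_coe, Ideal.mem_comap, Ideal.mem_span_singleton]
    exact TraceIdealDivisorial.foldr_gcd_dvd _ _ (List.mem_map.mpr ⟨g, Finset.mem_toList.mpr hg, rfl⟩)
  exact Ideal.mem_span_singleton.mp (hle hx)

/-- ★★ **A divisorial ideal is cut out by its gcd in a UFD cover.** `R ⊆ S` domains with `S ∩ Frac R = R` (hypothesis `hFrac`, e.g. `R`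
integrally closed and `S` integral over `R`, §1), `S` a UFD, `I = (G)` a divisorial (v-) ideal of `R`, `d = gcd_S(G)`: then
`x ∈ I ⟺ d ∣ x` in `S`. [cite: StacksProject, Tag 0AFW] [folklore] -/
theorem mem_iff_gcd_dvd_of_divisorial {R S : Type u} [CommRing R] [IsDomain R] [CommRing S] [IsDomain S] [Algebra R S]
    [UniqueFactorizationMonoid S] (hinj : Function.Injective (algebraMap R S))
    (hFrac : ∀ (x : S) (r₁ r₂ : R), r₂ ≠ 0 → algebraMap R S r₂ * x = algebraMap R S r₁ → ∃ r : R, algebraMap R S r = x)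
    (I : Ideal R)
    (hdiv : ∀ x : R, (∀ c b : R, (∀ y ∈ I, b * y ∈ Ideal.span ({c} : Set R)) → b * x ∈ Ideal.span ({c} : Set R)) → x ∈ I)
    (G : Finset R) (hG : Ideal.span (G : Set R) = I) :
    letI : GCDMonoid S := UniqueFactorizationMonoid.toGCDMonoid S
    ∀ x : R, x ∈ I ↔ (G.toList.map (algebraMap R S)).foldr gcd 0 ∣ algebraMap R S x := by
  letI : GCDMonoid S := UniqueFactorizationMonoid.toGCDMonoid S
  intro x
  refine ⟨fun hx => foldr_gcd_dvd_of_mem_span G (hG ▸ hx), fun hdx => hdiv x fun c b hbc => ?_⟩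
  obtain ⟨t, ht⟩ := hdx
  by_cases hc : c = 0
  · -- `b I = 0`: either `b = 0` or `I = 0` (then `d = 0` and `x = 0`)
    subst hc
    by_cases hb : b = 0
    · rw [hb, zero_mul]; exact Ideal.zero_mem _
    · have hI : ∀ y ∈ I, y = 0 := fun y hy => by
        have h := hbc y hy
        rw [Ideal.span_singleton_zero, Ideal.mem_bot] at h
        exact (mul_eq_zero.mp h).resolve_left hb
      have hd : (G.toList.map (algebraMap R S)).foldr gcd 0 = 0 := by
        have : ∀ g ∈ G.toList.map (algebraMap R S), g = 0 := by
          intro g hg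
          obtain ⟨g', hg', rfl⟩ := List.mem_map.mp hg
          rw [hI g' (hG ▸ Ideal.subset_span (Finset.mem_toList.mp hg')), map_zero]
        exact foldr_gcd_eq_zero _ this
      rw [hd, zero_mul] at ht
      have hx0 : x = 0 := hinj (by rw [ht, map_zero])
      rw [hx0, mul_zero]
      exact Ideal.zero_mem _
  · -- `c ∣ b d` in `S`, so `c ∣ b x` in `S`, and the quotient lies in `R`
    have hcd : algebraMap R S c ∣ algebraMap R S b * (G.toList.map (algebraMap R S)).foldr gcd 0 := by
      refine TraceIdealDivisorial.dvd_mul_foldr_gcd _ _ _ fun g hg => ?_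
      obtain ⟨g', hg', rfl⟩ := List.mem_map.mp hg
      rw [← map_mul, ← Ideal.mem_span_singleton]
      have h := hbc g' (hG ▸ Ideal.subset_span (Finset.mem_toList.mp hg'))
      rw [Ideal.mem_span_singleton] at h
      exact (Ideal.mem_span_singleton).mpr (map_dvd (algebraMap R S) h)
    obtain ⟨s₀, hs₀⟩ := hcd
    -- `b x = c (s₀ t)` in `S`
    have hbx : algebraMap R S c * (s₀ * t) = algebraMap R S (b * x) := by
      rw [map_mul, ht, ← mul_assoc, ← hs₀, mul_assoc]
    obtain ⟨r, hr⟩ := hFrac (s₀ * t) (b * x) c hc hbx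
    rw [Ideal.mem_span_singleton']
    refine ⟨r, hinj ?_⟩
    rw [map_mul, hr, mul_comm, hbx]

/-! ## §3 `I ≅ M_d = {s ∈ S : d s ∈ R}` -/

/-- ★ **`I ≅ M_d`.** Under the hypotheses of `mem_iff_gcd_dvd_of_divisorial` and `I ≠ 0`, division by `d = gcd_S(I)` is an `R`-linear
isomorphism from `I` onto the `R`-submodule `M_d = {s ∈ S : d·s ∈ R}` of `S`; so the isomorphism class of a divisorial ideal is that of
`M_d` for its gcd `d` (determined up to units of `S`). [folklore; Fossum §16] -/
theorem nonempty_linearEquiv_of_divisorial {R S : Type u} [CommRing R] [IsDomain R] [CommRing S] [IsDomain S] [Algebra R S]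
    [UniqueFactorizationMonoid S] (hinj : Function.Injective (algebraMap R S))
    (hFrac : ∀ (x : S) (r₁ r₂ : R), r₂ ≠ 0 → algebraMap R S r₂ * x = algebraMap R S r₁ → ∃ r : R, algebraMap R S r = x)
    (I : Ideal R) (hI : I ≠ ⊥)
    (hdiv : ∀ x : R, (∀ c b : R, (∀ y ∈ I, b * y ∈ Ideal.span ({c} : Set R)) → b * x ∈ Ideal.span ({c} : Set R)) → x ∈ I)
    (G : Finset R) (hG : Ideal.span (G : Set R) = I) :
    letI : GCDMonoid S := UniqueFactorizationMonoid.toGCDMonoid S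
    Nonempty (I ≃ₗ[R] ↥((LinearMap.range (Algebra.linearMap R S)).comap
      (LinearMap.mulLeft R ((G.toList.map (algebraMap R S)).foldr gcd 0)))) := by
  letI : GCDMonoid S := UniqueFactorizationMonoid.toGCDMonoid S
  have hmem := mem_iff_gcd_dvd_of_divisorial hinj hFrac I hdiv G hG
  -- name the gcd and the target module without `set` (keeps hypotheses syntactically stable)
  obtain ⟨d, hd⟩ : ∃ d : S, (G.toList.map (algebraMap R S)).foldr gcd 0 = d := ⟨_, rfl⟩
  rw [hd] at hmem ⊢
  -- `d ≠ 0`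
  have hd0 : d ≠ 0 := by
    intro hd0
    apply hI
    refine (Submodule.eq_bot_iff _).mpr fun y hy => hinj ?_
    obtain ⟨t, ht⟩ := (hmem y).mp hy
    rw [ht, hd0, zero_mul, map_zero]
  -- the quotient map `x ↦ x / d`
  have hex : ∀ x : I, ∃ t : S, algebraMap R S x = d * t := fun x => (hmem x).mp x.2
  choose q hq using hex
  have hqu : ∀ (x : I) (t : S), algebraMap R S x = d * t → t = q x := fun x t ht =>
    mul_left_cancel₀ hd0 (ht.symm.trans (hq x))
  have hqmem : ∀ x : I, q x ∈ (LinearMap.range (Algebra.linearMap R S)).comap (LinearMap.mulLeft R d) := fun x =>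
    ⟨(x : R), by rw [Algebra.linearMap_apply, LinearMap.mulLeft_apply, hq x]⟩
  let ψ : I →ₗ[R] ↥((LinearMap.range (Algebra.linearMap R S)).comap (LinearMap.mulLeft R d)) :=
    { toFun := fun x => ⟨q x, hqmem x⟩
      map_add' := fun x y => by
        ext
        change q (x + y) = q x + q y
        refine (hqu (x + y) _ ?_).symm
        rw [Submodule.coe_add, map_add, hq x, hq y, mul_add]
      map_smul' := fun a x => by
        ext
        change q (a • x) = a • q x
        refine (hqu (a • x) _ ?_).symm
        rw [SetLike.val_smul, smul_eq_mul, map_mul, hq x, Algebra.smul_def, mul_left_comm] }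
  refine ⟨LinearEquiv.ofBijective ψ ⟨?_, ?_⟩⟩
  · intro x y hxy
    have h : q x = q y := congrArg (fun z : ↥((LinearMap.range (Algebra.linearMap R S)).comap (LinearMap.mulLeft R d)) => (z : S)) hxy
    apply Subtype.ext
    apply hinj
    rw [hq x, hq y, h]
  · rintro ⟨s, ⟨r, hr⟩⟩
    rw [Algebra.linearMap_apply, LinearMap.mulLeft_apply] at hr
    have hrI : r ∈ I := (hmem r).mpr ⟨s, hr⟩
    refine ⟨⟨r, hrI⟩, Subtype.ext ?_⟩
    change q ⟨r, hrI⟩ = s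
    exact (hqu ⟨r, hrI⟩ s hr).symm

end Summit.ResolutionOfSingularities.ResolutionOfSingularities.Theorems.FRationalResolution.DivisorialGcd
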